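import Mathlib
import Summits.NavierStokesRegularity.NavierStokesRegularity.Theorems.FilamentSkeletonRssClause13ExteriorInductionL2
import Summits.NavierStokesRegularity.NavierStokesRegularity.Theorems.FilamentSkeletonRssClause13ExteriorInductionKq

/-!
# Clause 13-J/13-R, edge brick E4 (MODEL-KERNEL COROLLARY): exterior `L²` induction of a clamped variation `≤ (4/q)·∫‖Y′‖²`

Route `FilamentSkeletonRss`, ∃-side clause 13 (`Clause13RNearStraightL`, stmt-NavierStokesRegularity-23612; typing-agnostic).  Puts together
E2 (`integral_Ioi_sq_norm_kernel_clamped_le`, generic kernel) and E3 (`hasDerivAt_kernelAntideriv`, `integral_Ioi_abs_kernelAntideriv_le`: the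
model kernel's explicit antiderivative with tail integral `≤ 2/√q`): for the model kernel `K_q(s) = (2q − s²)(s²+q)^{-5/2}` and every
`Y ∈ C¹_c(ℝ, ℂ)` vanishing on `[e, ∞)` (a test variation beyond an exit point `e` of the tangency ball),
`∫_{x>e} ‖∫ K_q(x−σ)Y(σ)dσ‖² ≤ (4/q)·∫‖Y′‖²` — the exterior sliver of the model defect (`−iG·K_q∗Y` outside the ball, design memo
`filament-plan/DESIGN-23612-currency-b-edge-lane-g19.md` §9) is controlled in `L²` by the in-ball slope energy, Γ-free.
Lane ns-filament-19175-p1 g19; `--supports stmt-NavierStokesRegularity-23612 --as helper`.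
HONEST FRAMING: an elementary inequality used in the bookkeeping of a HYPOTHETICAL filament skeleton on the NEGATIVE side of a MODEL route; nothing here
bears on Navier–Stokes regularity or blow-up.
-/

noncomputable section

open MeasureTheory Real Set

namespace Summit.NavierStokesRegularity.NavierStokesRegularity.Theorems.MatchedKernel
set_option linter.dupNamespace false

/-- **EXTERIOR `L²` INDUCTION OF A CLAMPED VARIATION, MODEL KERNEL.**  `q > 0`, `Y ∈ C¹_c(ℝ, ℂ)` with `Y = 0` on `[e, ∞)`:
`∫_{x ∈ (e,∞)} ‖∫ (2q − (x−σ)²)((x−σ)²+q)^{-5/2}·Y(σ) dσ‖² ≤ (4/q)·∫‖Y′‖²`. [folklore] -/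
theorem integral_Ioi_sq_norm_smoothingPiece_clamped_le {q : ℝ} (hq : 0 < q) {Y : ℝ → ℂ} (hY : ContDiff ℝ 1 Y)
    (hYs : HasCompactSupport Y) {e : ℝ} (hYe : ∀ σ, e ≤ σ → Y σ = 0) :
    ∫ x in Ioi e, ‖∫ σ : ℝ, ((((2 * q - (x - σ) ^ 2) * (((x - σ) ^ 2 + q) ^ (5 / 2 : ℝ))⁻¹ : ℝ)) : ℂ) * Y σ‖ ^ 2
      ≤ 4 / q * ∫ σ : ℝ, ‖deriv Y σ‖ ^ 2 := by
  obtain ⟨hint, hle⟩ := integral_Ioi_abs_kernelAntideriv_le hq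
  have h := integral_Ioi_sq_norm_kernel_clamped_le (K := fun s : ℝ => (2 * q - s ^ 2) * ((s ^ 2 + q) ^ (5 / 2 : ℝ))⁻¹)
    (Kt := fun u : ℝ => (u * (u ^ 2 + 2 * q) / ((u ^ 2 + q) * Real.sqrt (u ^ 2 + q)) - 1) / q)
    (fun t => hasDerivAt_kernelAntideriv hq t) (continuous_smoothingKernel hq) hint hY hYs hYe
  refine h.trans ?_
  have h0 : 0 ≤ ∫ t in Ioi (0 : ℝ), |(t * (t ^ 2 + 2 * q) / ((t ^ 2 + q) * Real.sqrt (t ^ 2 + q)) - 1) / q| :=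
    integral_nonneg fun t => abs_nonneg _
  have hsq : (∫ t in Ioi (0 : ℝ), |(t * (t ^ 2 + 2 * q) / ((t ^ 2 + q) * Real.sqrt (t ^ 2 + q)) - 1) / q|) ^ 2 ≤ (2 / Real.sqrt q) ^ 2 :=
    pow_le_pow_left₀ h0 hle 2
  have h4 : (2 / Real.sqrt q) ^ 2 = 4 / q := by
    rw [div_pow, Real.sq_sqrt hq.le]; norm_num
  have hY' : 0 ≤ ∫ σ : ℝ, ‖deriv Y σ‖ ^ 2 := integral_nonneg fun σ => sq_nonneg _
  calc (∫ t in Ioi (0 : ℝ), |(t * (t ^ 2 + 2 * q) / ((t ^ 2 + q) * Real.sqrt (t ^ 2 + q)) - 1) / q|) ^ 2 * ∫ σ : ℝ, ‖deriv Y σ‖ ^ 2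
      ≤ (2 / Real.sqrt q) ^ 2 * ∫ σ : ℝ, ‖deriv Y σ‖ ^ 2 := mul_le_mul_of_nonneg_right hsq hY'
    _ = 4 / q * ∫ σ : ℝ, ‖deriv Y σ‖ ^ 2 := by rw [h4]

end Summit.NavierStokesRegularity.NavierStokesRegularity.Theorems.MatchedKernel

end
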